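import Summits.ValiantsHypothesis.ValiantsHypothesis.Theses.DivisionGap
import Literature.Computability.AlgebraicComplexity.PermanentIrreducible
import Literature.Computability.AlgebraicComplexity.RankOneDeterminantalExpressionsProofs

/-!
# `DivisionGap.PerCofactorDegreeReduction` (stmt-ValiantsHypothesis-15046), line `Sketch`:
# the degree window `n + 1` of `stub_automaticPositivity` is SHARP — negative knowledge from the
# standing disprover

The picked line (`Cruxes/PerCofactorDegreeReduction/PICKED.md`) discharges the low-degree window of
its open stub K2 (`stub_cheapPositivization`, stated for signed cofactors of degree `≥ n + 2`) by

  `stub_automaticPositivity : ∀ n (q : ℝ[x_ij]), deg q ≤ n + 1 → per_n · q ≥ 0 (coefficientwise) → q ≥ 0`.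

That stub is TRUE (unique-matching ordering argument, card `prime-walk-positivizer`).  Here we record,
kernel-checked, that its window cannot be widened by one: with `n + 1` replaced by `n + 2` the
statement is FALSE already at `n = 2` — the permanent `per₂ = a + b` (`a = x₀₀x₁₁`, `b = x₁₀x₀₁`)
has the SIGNED cofactor `q = a² − ab + b²` of degree `4 = n + 2` with `per₂ · q = a³ + b³ ≥ 0`
(`not_automaticPositivity_add_two`).  So the first signed cofactor degree is exactly `d*(n) = n + 2`
at `n = 2` (and, by the LP runs kit j015655 / j015673 of the ideator, at `n = 3, 4`; for every
`n ≥ 2` the exponent `x₀₀⋯x_{n-3,n-3} · (x_{n-2,n-2} x_{n-2,n-1} x_{n-1,n-2} x_{n-1,n-1})` carries a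
negative coefficient of a degree-`(n+2)` signed cofactor — paper, Disproof.lean §(c)).  Consequence
for the line: the hypothesis `n + 2 ≤ q.totalDegree` of K2 is exactly where signed cofactors start;
K2 has no slack to absorb from `stub_automaticPositivity`.

Also recorded (`not_polya_positivizer`, `coeff_eT_sx_pow_mul_q2`): the universal Pólya multiplier
`(Σ_v x_v)^N` NEVER positivizes this `q` (coefficient `−1` at `x₀₀^{N+1}x₁₁x₁₀x₀₁` for every `N`; `q`
vanishes at a vertex of the simplex), while `per₂` does — positivizers for K2 must be adapted to `q`.

All statements are inline (no new named facts); `pa`, `pb`, `q2`, `mab`, `sx`, `eT` are the explicit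
witnesses.
-/

noncomputable section

namespace Summit.ValiantsHypothesis.Theorems.PerCofactorDegreeReductionNegative

open MvPolynomial Literature.Computability.AlgebraicComplexity

/-- `a = x₀₀ x₁₁`, the diagonal monomial of `per₂`. [folklore] -/
def pa : MvPolynomial (Fin 2 × Fin 2) ℝ := X ((0 : Fin 2), (0 : Fin 2)) * X ((1 : Fin 2), (1 : Fin 2))

/-- `b = x₁₀ x₀₁`, the anti-diagonal monomial of `per₂`. [folklore] -/
def pb : MvPolynomial (Fin 2 × Fin 2) ℝ := X ((1 : Fin 2), (0 : Fin 2)) * X ((0 : Fin 2), (1 : Fin 2))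

/-- The signed cofactor `q = a² − ab + b²` (degree `4 = n + 2`). [folklore] -/
def q2 : MvPolynomial (Fin 2 × Fin 2) ℝ := pa * pa - pa * pb + pb * pb

/-- `per₂ = a + b` (tree: `permanent_fin_two`). [folklore] -/
theorem perPoly_two_eq : perPoly (Fin 2) ℝ = pa + pb := by
  rw [perPoly, permanent_fin_two, pa, pb]
  simp [Matrix.mvPolynomialX_apply]

/-- `per₂ · q = a³ + b³`. [folklore] -/
theorem perPoly_two_mul_q2 : perPoly (Fin 2) ℝ * q2 = pa ^ 3 + pb ^ 3 := by
  rw [perPoly_two_eq, q2]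
  ring

/-- `a³` is a monomial with coefficient `1`. [folklore] -/
theorem pa_pow_three : pa ^ 3 =
    monomial (Finsupp.single ((0 : Fin 2), (0 : Fin 2)) 3 + Finsupp.single ((1 : Fin 2), (1 : Fin 2)) 3) 1 := by
  rw [pa, mul_pow, X_pow_eq_monomial, X_pow_eq_monomial, monomial_mul, mul_one]

/-- `b³` is a monomial with coefficient `1`. [folklore] -/
theorem pb_pow_three : pb ^ 3 =
    monomial (Finsupp.single ((1 : Fin 2), (0 : Fin 2)) 3 + Finsupp.single ((0 : Fin 2), (1 : Fin 2)) 3) 1 := by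
  rw [pb, mul_pow, X_pow_eq_monomial, X_pow_eq_monomial, monomial_mul, mul_one]

/-- `per₂ · q ≥ 0` coefficientwise. [folklore] -/
theorem coeff_perPoly_two_mul_q2_nonneg (m : (Fin 2 × Fin 2) →₀ ℕ) :
    0 ≤ coeff m (perPoly (Fin 2) ℝ * q2) := by
  rw [perPoly_two_mul_q2, coeff_add, pa_pow_three, pb_pow_three, coeff_monomial, coeff_monomial]
  split_ifs <;> norm_num

/-- `deg q ≤ 4`. [folklore] -/
theorem totalDegree_q2_le : q2.totalDegree ≤ 2 + 2 := by
  have ha : pa.totalDegree ≤ 2 := by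
    refine (totalDegree_mul _ _).trans ?_
    rw [totalDegree_X, totalDegree_X]
  have hb : pb.totalDegree ≤ 2 := by
    refine (totalDegree_mul _ _).trans ?_
    rw [totalDegree_X, totalDegree_X]
  have haa : (pa * pa).totalDegree ≤ 4 := (totalDegree_mul _ _).trans (by omega)
  have hab : (pa * pb).totalDegree ≤ 4 := (totalDegree_mul _ _).trans (by omega)
  have hbb : (pb * pb).totalDegree ≤ 4 := (totalDegree_mul _ _).trans (by omega)
  have h1 : (pa * pa - pa * pb).totalDegree ≤ 4 :=
    (totalDegree_sub _ _).trans (max_le haa hab)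
  exact (totalDegree_add _ _).trans (max_le h1 hbb)

/-- The exponent of `ab = x₀₀ x₁₁ x₁₀ x₀₁`. [folklore] -/
def mab : (Fin 2 × Fin 2) →₀ ℕ :=
  Finsupp.single ((0 : Fin 2), (0 : Fin 2)) 1 + Finsupp.single ((1 : Fin 2), (1 : Fin 2)) 1 +
    (Finsupp.single ((1 : Fin 2), (0 : Fin 2)) 1 + Finsupp.single ((0 : Fin 2), (1 : Fin 2)) 1)

/-- `ab` is the monomial with exponent `mab`. [folklore] -/
theorem pa_mul_pb : pa * pb = monomial mab 1 := by
  rw [pa, pb, X, X, X, X, monomial_mul, monomial_mul, monomial_mul, mab]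
  norm_num

/-- `a²` as a monomial. [folklore] -/
theorem pa_mul_pa : pa * pa = monomial
    (Finsupp.single ((0 : Fin 2), (0 : Fin 2)) 1 + Finsupp.single ((1 : Fin 2), (1 : Fin 2)) 1 +
      (Finsupp.single ((0 : Fin 2), (0 : Fin 2)) 1 + Finsupp.single ((1 : Fin 2), (1 : Fin 2)) 1)) 1 := by
  rw [pa, X, X, monomial_mul, monomial_mul]
  norm_num

/-- `b²` as a monomial. [folklore] -/
theorem pb_mul_pb : pb * pb = monomial
    (Finsupp.single ((1 : Fin 2), (0 : Fin 2)) 1 + Finsupp.single ((0 : Fin 2), (1 : Fin 2)) 1 +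
      (Finsupp.single ((1 : Fin 2), (0 : Fin 2)) 1 + Finsupp.single ((0 : Fin 2), (1 : Fin 2)) 1)) 1 := by
  rw [pb, X, X, monomial_mul, monomial_mul]
  norm_num

/-- The exponents of `a²` and `ab` differ. [folklore] -/
theorem aa_ne_mab :
    (Finsupp.single ((0 : Fin 2), (0 : Fin 2)) 1 + Finsupp.single ((1 : Fin 2), (1 : Fin 2)) 1 +
      (Finsupp.single ((0 : Fin 2), (0 : Fin 2)) 1 + Finsupp.single ((1 : Fin 2), (1 : Fin 2)) 1) :
      (Fin 2 × Fin 2) →₀ ℕ) ≠ mab := by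
  rw [mab, Ne, ← DFunLike.coe_fn_eq]
  simp only [Finsupp.coe_add, Finsupp.single_eq_pi_single]
  decide

/-- The exponents of `b²` and `ab` differ. [folklore] -/
theorem bb_ne_mab :
    (Finsupp.single ((1 : Fin 2), (0 : Fin 2)) 1 + Finsupp.single ((0 : Fin 2), (1 : Fin 2)) 1 +
      (Finsupp.single ((1 : Fin 2), (0 : Fin 2)) 1 + Finsupp.single ((0 : Fin 2), (1 : Fin 2)) 1) :
      (Fin 2 × Fin 2) →₀ ℕ) ≠ mab := by
  rw [mab, Ne, ← DFunLike.coe_fn_eq]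
  simp only [Finsupp.coe_add, Finsupp.single_eq_pi_single]
  decide

/-- The coefficient of `ab` in `q` is `−1`. [folklore] -/
theorem coeff_mab_q2 : coeff mab q2 = -1 := by
  rw [q2, coeff_add, coeff_sub, pa_mul_pb, pa_mul_pa, pb_mul_pb, coeff_monomial, coeff_monomial,
    coeff_monomial, if_neg aa_ne_mab, if_pos rfl, if_neg bb_ne_mab]
  norm_num

/-- **The window `n + 1` of `stub_automaticPositivity` is sharp**: widened to `n + 2` the statement
fails at `n = 2`, `q = a² − ab + b²` (`per₂ · q = a³ + b³ ≥ 0`, `coeff_{ab} q = −1`).  Hence signed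
cofactors of nonnegative multiples of `per_n` exist from degree `n + 2` on, and the hypothesis
`n + 2 ≤ q.totalDegree` of K2 (`stub_cheapPositivization`) starts exactly at the first signed degree.
[folklore] -/
theorem not_automaticPositivity_add_two :
    ¬ ∀ (n : ℕ) (q : MvPolynomial (Fin n × Fin n) ℝ), q.totalDegree ≤ n + 2 →
        (∀ m, 0 ≤ coeff m (perPoly (Fin n) ℝ * q)) → ∀ m, 0 ≤ coeff m q := by
  intro H
  have h := H 2 q2 totalDegree_q2_le coeff_perPoly_two_mul_q2_nonneg mab
  rw [coeff_mab_q2] at h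
  norm_num at h

/-- The same witness, packaged positively: a signed cofactor of degree `n + 2` at `n = 2`. [folklore] -/
theorem exists_signed_cofactor_degree_add_two :
    ∃ q : MvPolynomial (Fin 2 × Fin 2) ℝ, q.totalDegree ≤ 2 + 2 ∧
      (∀ m, 0 ≤ coeff m (perPoly (Fin 2) ℝ * q)) ∧ ∃ m, coeff m q < 0 :=
  ⟨q2, totalDegree_q2_le, coeff_perPoly_two_mul_q2_nonneg, mab, by rw [coeff_mab_q2]; norm_num⟩

/-! ### No Pólya shortcut: the universal multiplier `(Σ x)^N` never positivizes `q` -/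

/-- The sum of the three variables other than `x₀₀`. [folklore] -/
def rest : MvPolynomial (Fin 2 × Fin 2) ℝ :=
  X ((0 : Fin 2), (1 : Fin 2)) + (X ((1 : Fin 2), (0 : Fin 2)) + X ((1 : Fin 2), (1 : Fin 2)))

/-- The sum of all four variables, `Σ_v x_v = x₀₀ + rest`. [folklore] -/
def sx : MvPolynomial (Fin 2 × Fin 2) ℝ := X ((0 : Fin 2), (0 : Fin 2)) + rest

/-- `Σ_v x_v` is literally the sum over all cells. [folklore] -/
theorem sx_eq_sum : sx = ∑ v : Fin 2 × Fin 2, X v := by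
  rw [Fintype.sum_prod_type, Fin.sum_univ_two, Fin.sum_univ_two, Fin.sum_univ_two, sx, rest]
  ring

/-- `rest` does not involve `x₀₀`. [folklore] -/
theorem degreeOf_rest : degreeOf ((0 : Fin 2), (0 : Fin 2)) rest = 0 := by
  have hX : ∀ w : Fin 2 × Fin 2, ((0 : Fin 2), (0 : Fin 2)) ≠ w →
      degreeOf ((0 : Fin 2), (0 : Fin 2)) (X w : MvPolynomial (Fin 2 × Fin 2) ℝ) = 0 := fun w h => by
    rw [degreeOf_X, if_neg h]
  have hadd : ∀ f g : MvPolynomial (Fin 2 × Fin 2) ℝ, degreeOf ((0 : Fin 2), (0 : Fin 2)) f = 0 →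
      degreeOf ((0 : Fin 2), (0 : Fin 2)) g = 0 → degreeOf ((0 : Fin 2), (0 : Fin 2)) (f + g) = 0 :=
    fun f g hf hg => Nat.le_zero.mp ((degreeOf_add_le _ f g).trans (by rw [hf, hg, max_self]))
  exact hadd _ _ (hX _ (by decide)) (hadd _ _ (hX _ (by decide)) (hX _ (by decide)))

/-- A power of `rest` has no monomial with a positive `x₀₀`-exponent. [folklore] -/
theorem coeff_rest_pow_eq_zero {m : (Fin 2 × Fin 2) →₀ ℕ} (hm : 0 < m ((0 : Fin 2), (0 : Fin 2)))
    (j : ℕ) : coeff m (rest ^ j) = 0 := by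
  rw [← notMem_support_iff]
  intro hmem
  have h1 := monomial_le_degreeOf ((0 : Fin 2), (0 : Fin 2)) hmem
  have h2 : degreeOf ((0 : Fin 2), (0 : Fin 2)) (rest ^ j) = 0 :=
    Nat.le_zero.mp ((degreeOf_pow_le _ _ j).trans (by rw [degreeOf_rest, mul_zero]))
  omega

/-- **`coeff_{x₀₀^N} (Σ_v x_v)^N = 1`.** [folklore] -/
theorem coeff_sx_pow (N : ℕ) : coeff (Finsupp.single ((0 : Fin 2), (0 : Fin 2)) N) (sx ^ N) = 1 := by
  rw [sx, add_pow, coeff_sum, Finset.sum_eq_single_of_mem N (Finset.mem_range.mpr (Nat.lt_succ_self N))]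
  · rw [Nat.sub_self, pow_zero, mul_one, Nat.choose_self, Nat.cast_one, mul_one, X_pow_eq_monomial,
      coeff_monomial, if_pos rfl]
  · intro k hk hkN
    have hk' : k < N := lt_of_le_of_ne (Nat.lt_succ_iff.mp (Finset.mem_range.mp hk)) hkN
    rw [X_pow_eq_monomial, mul_assoc, coeff_monomial_mul']
    split_ifs with hle
    · rw [mul_comm (rest ^ (N - k)), ← map_natCast (C : ℝ →+* MvPolynomial (Fin 2 × Fin 2) ℝ),
        coeff_C_mul, coeff_rest_pow_eq_zero, mul_zero, mul_zero]
      simp only [Finsupp.tsub_apply, Finsupp.single_eq_same]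
      omega
    · rfl

/-- The exponent `x₀₀^N · x₀₀x₁₁x₁₀x₀₁`. [folklore] -/
def eT (N : ℕ) : (Fin 2 × Fin 2) →₀ ℕ := Finsupp.single ((0 : Fin 2), (0 : Fin 2)) N + mab

/-- **`coeff_{x₀₀^{N+1}x₁₁x₁₀x₀₁} ((Σ_v x_v)^N · q) = −1` for every `N`.**  The monomial
`x₀₀^{N+1}x₁₁x₁₀x₀₁` is reached only through `x₀₀^N · (−ab)`: the squares `a²`, `b²` carry `x₁₁²`,
`x₁₀²`. [folklore] -/
theorem coeff_eT_sx_pow_mul_q2 (N : ℕ) : coeff (eT N) (sx ^ N * q2) = -1 := by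
  have hAA : ¬ (Finsupp.single ((0 : Fin 2), (0 : Fin 2)) 1 + Finsupp.single ((1 : Fin 2), (1 : Fin 2)) 1 +
      (Finsupp.single ((0 : Fin 2), (0 : Fin 2)) 1 + Finsupp.single ((1 : Fin 2), (1 : Fin 2)) 1) :
      (Fin 2 × Fin 2) →₀ ℕ) ≤ eT N := fun h => by
    have := Finsupp.le_def.mp h ((1 : Fin 2), (1 : Fin 2))
    simp [eT, mab] at this
  have hBB : ¬ (Finsupp.single ((1 : Fin 2), (0 : Fin 2)) 1 + Finsupp.single ((0 : Fin 2), (1 : Fin 2)) 1 +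
      (Finsupp.single ((1 : Fin 2), (0 : Fin 2)) 1 + Finsupp.single ((0 : Fin 2), (1 : Fin 2)) 1) :
      (Fin 2 × Fin 2) →₀ ℕ) ≤ eT N := fun h => by
    have := Finsupp.le_def.mp h ((1 : Fin 2), (0 : Fin 2))
    simp [eT, mab] at this
  have hAB : mab ≤ eT N := by rw [eT]; exact le_add_self
  rw [q2, mul_add, mul_sub, coeff_add, coeff_sub, pa_mul_pa, pa_mul_pb, pb_mul_pb,
    coeff_mul_monomial', coeff_mul_monomial', coeff_mul_monomial', if_neg hAA, if_neg hBB,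
    if_pos hAB, eT, add_tsub_cancel_right, coeff_sx_pow]
  norm_num

/-- **No Pólya shortcut for K2.**  The universal cheap multiplier `(Σ_v x_v)^N` (Pólya's theorem
positivizes forms that are STRICTLY positive on the simplex) never positivizes the signed cofactor
`q = a² − ab + b²` of `per₂`: `q` vanishes at the vertex `x₀₀ = 1` of the simplex, and the
coefficient of `x₀₀^{N+1}x₁₁x₁₀x₀₁` in `(Σ_v x_v)^N · q` is `−1` for every `N`.  (By contrast
`per₂ · q = a³ + b³ ≥ 0`.)  Positivizers for `stub_cheapPositivization` must be adapted to `q`.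
[folklore] -/
theorem not_polya_positivizer :
    ¬ ∃ N : ℕ, ∀ m, 0 ≤ coeff m ((∑ v : Fin 2 × Fin 2, X v) ^ N * q2) := by
  rintro ⟨N, hN⟩
  have h := hN (eT N)
  rw [← sx_eq_sum, coeff_eT_sx_pow_mul_q2] at h
  norm_num at h

end Summit.ValiantsHypothesis.Theorems.PerCofactorDegreeReductionNegative

end
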